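import Mathlib
import Literature.AlgebraicGeometry.Resolution.RsopMonomialIdeals

/-!
# TropicalLinks / InductiveStep — the boundary of the concrete charts is a strict normal crossings divisor

Route `ResolutionOfSingularities/TropicalLinks`, crux `InductiveStep` (stmt-ResolutionOfSingularities-17233),
line `split`, producer brick DTb (transfer of the snc clause at infinity from the datum to the chart
subalgebras of the fraction field, in `IsRsopPart` form), in support of stub `stub_valuativeCharts`.

Setting: `B` is a domain over the field `k`, `f : Fin n → B`, `K = Frac B`, `f' := Fin.cons 1 f` (so
`f'₀ = 1`, `f'_{i+1} = fᵢ`). The datum of the child `SncClosureSchon` presents the charts at infinity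
of the projective closure `Ȳ ⊆ ℙⁿ` of `Spec B` ABSTRACTLY as
`C_i := k[X₀ … X_n] ⧸ ker (X₀ ↦ 1/fᵢ, X_{j+1} ↦ fⱼ/fᵢ)` (evaluation into `Localization.Away (f i)`)
and says: at every prime `P` of `C_i` containing the class of `X₀` (the equation of the hyperplane
at infinity) the local ring has dimension `r + e`, its maximal ideal is generated by a family
`(x, y)` of `r + e` elements with `r ≥ 1`, and `√(X₀) = (∏ x_l)` — the boundary is a strict normal
crossings divisor (Stacks 0BI9). The producer works with the CONCRETE chart subalgebras
`𝒞_h := k[f'_j / f'_h : j] ⊆ K` and the element `t = 1/f'_h ∈ 𝒞_h`. This file proves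
(`tropicalLinks_projChart_snc`) the same clause on `𝒞_h` for `t`, stated with the tree's
`Literature.AlgebraicGeometry.Resolution.IsRsopPart`:

* `h = 0`: `f'₀ = 1` forces `t = 1`, which lies in no prime — the clause is vacuous;
* `h = i + 1` (`fᵢ ≠ 0`): the lift `φ : B[fᵢ⁻¹] → K` of `B → K` is injective and sends the
  generators `1/fᵢ, fⱼ/fᵢ` of `C_i` to those of `𝒞_h`, whence a ring isomorphism `ε : C_i ≅ 𝒞_h`
  with `ε [X₀] = 1/fᵢ = t` (`tropicalLinks_projChart_snc_exists_chartEquiv`); the clause is then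
  transported along `ε` and the induced isomorphism of local rings
  `(C_i)_{ε⁻¹ Q} ≅ (𝒞_h)_Q` (`tropicalLinks_projChart_snc_transport`): Krull dimension, the span of
  the parameters, the maximal ideal and `√(t) = (∏ x_l)` are all invariant, and regularity of the
  local ring — the extra conjunct of `IsRsopPart` — FOLLOWS from the datum, a Noetherian local ring of
  dimension `r + e` whose maximal ideal is `(r + e)`-generated being regular
  (`tropicalLinks_projChart_snc_isRsopPart_of_span_eq`).
-/

-- single-problem summit: the doubled namespace component `ResolutionOfSingularities` is forced
set_option linter.dupNamespace false

namespace Summit.ResolutionOfSingularities.ResolutionOfSingularities.Theorems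

open IsLocalRing Literature.AlgebraicGeometry.Resolution

/-- Transport of a part of a regular system of parameters along a ring isomorphism of local rings
(local copy of the tree's `IsRsopPart.map_ringEquiv`, to keep the imports light). [folklore] -/
theorem tropicalLinks_projChart_snc_isRsopPart_map_ringEquiv {R R' : Type*} [CommRing R]
    [CommRing R'] [IsLocalRing R] [IsLocalRing R'] (ε : R ≃+* R') {m : ℕ} {z : Fin m → R}
    (hz : IsRsopPart z) : IsRsopPart (ε ∘ z) := by
  obtain ⟨hR, e, y, hdim, hspan⟩ := hz
  haveI := hR
  refine ⟨IsRegularLocalRing.of_ringEquiv ε, e, ε ∘ y, ?_, ?_⟩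
  · rw [← hdim]
    exact (ringKrullDim_eq_of_ringEquiv ε).symm
  · have h1 : Set.range (⇑ε ∘ z) ∪ Set.range (⇑ε ∘ y) = ε '' (Set.range z ∪ Set.range y) := by
      rw [Set.image_union, Set.range_comp, Set.range_comp]
    rw [h1, ← IsLocalRing.map_ringEquiv_maximalIdeal ε, ← hspan, Ideal.map_span]

/-- In a Noetherian local ring of Krull dimension `r + e` whose maximal ideal is generated by
`x₁, …, x_r, y₁, …, y_e`, the ring is regular (its embedding dimension is at most `r + e = dim`,
`IsRegularLocalRing.of_spanFinrank_maximalIdeal_le`) and `x` is part of a regular system of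
parameters. [folklore] -/
theorem tropicalLinks_projChart_snc_isRsopPart_of_span_eq {R : Type*} [CommRing R] [IsLocalRing R]
    [IsNoetherianRing R] {r e : ℕ} {x : Fin r → R} {y : Fin e → R}
    (hdim : ringKrullDim R = ((r + e : ℕ) : WithBot ℕ∞))
    (hspan : Ideal.span (Set.range x ∪ Set.range y) = maximalIdeal R) : IsRsopPart x := by
  have hfin : (Set.range x ∪ Set.range y).Finite := (Set.finite_range x).union (Set.finite_range y)
  have hsf : (maximalIdeal R).spanFinrank ≤ r + e := by
    rw [← hspan]
    refine (Submodule.spanFinrank_span_le_ncard_of_finite hfin).trans ?_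
    refine (Set.ncard_union_le _ _).trans (add_le_add ?_ ?_)
    · have h := Set.ncard_image_le (f := x) (s := Set.univ) Set.finite_univ
      rwa [Set.image_univ, Set.ncard_univ, Nat.card_eq_fintype_card, Fintype.card_fin] at h
    · have h := Set.ncard_image_le (f := y) (s := Set.univ) Set.finite_univ
      rwa [Set.image_univ, Set.ncard_univ, Nat.card_eq_fintype_card, Fintype.card_fin] at h
  have hreg : IsRegularLocalRing R :=
    IsRegularLocalRing.of_spanFinrank_maximalIdeal_le R (by rw [hdim]; exact_mod_cast hsf)
  exact ⟨hreg, e, y, hdim, hspan⟩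

/-- **Transport of the snc clause along a ring isomorphism.** Let `ε : C ≃+* C'` with `C`
Noetherian and `s ∈ C`. If at every prime `P ∋ s` of `C` the local ring `C_P` has dimension
`r + e`, maximal ideal `(x, y)` with `x : Fin r → C_P`, `y : Fin e → C_P`, `r ≥ 1`, and
`√(s) = (∏ x_l)`, then at every prime `Q ∋ ε s` of `C'` there is a part `x'` of a regular system of
parameters of `C'_Q` of length `r ≥ 1` with `√(ε s) = (∏ x'_l)`: take `P := ε⁻¹ Q` and push the
data through the induced isomorphism `C_P ≅ C'_Q` (`IsLocalization.ringEquivOfRingEquiv`).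
[folklore] -/
theorem tropicalLinks_projChart_snc_transport {C C' : Type*} [CommRing C] [CommRing C']
    [IsNoetherianRing C] (ε : C ≃+* C') (s : C)
    (hs : ∀ (P : Ideal C) [P.IsPrime], s ∈ P → ∃ (r e : ℕ) (x : Fin r → Localization.AtPrime P)
      (y : Fin e → Localization.AtPrime P), 1 ≤ r ∧
        ringKrullDim (Localization.AtPrime P) = ((r + e : ℕ) : WithBot ℕ∞) ∧
        Ideal.span (Set.range x ∪ Set.range y) = maximalIdeal (Localization.AtPrime P) ∧
        (Ideal.span {algebraMap C (Localization.AtPrime P) s}).radical = Ideal.span {∏ l, x l})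
    (Q : Ideal C') [Q.IsPrime] (hQ : ε s ∈ Q) :
    ∃ (r : ℕ) (x : Fin r → Localization.AtPrime Q), 1 ≤ r ∧ IsRsopPart x ∧
      (Ideal.span {algebraMap C' (Localization.AtPrime Q) (ε s)}).radical =
        Ideal.span {∏ l, x l} := by
  obtain ⟨r, e, x, y, hr, hdim, hspan, hrad⟩ := hs (Q.comap ε) (Ideal.mem_comap.mpr hQ)
  have hH : Submonoid.map ε.toMonoidHom (Q.comap ε).primeCompl = Q.primeCompl :=
    ε.map_primeCompl_comap_eq Q
  -- the induced isomorphism of local rings, compatible with the structure maps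
  let η : Localization.AtPrime (Q.comap ε) ≃+* Localization.AtPrime Q :=
    IsLocalization.ringEquivOfRingEquiv (Localization.AtPrime (Q.comap ε)) (Localization.AtPrime Q)
      ε hH
  have hη : ∀ c : C, η (algebraMap C (Localization.AtPrime (Q.comap ε)) c) =
      algebraMap C' (Localization.AtPrime Q) (ε c) := fun c =>
    IsLocalization.ringEquivOfRingEquiv_eq hH c
  refine ⟨r, η ∘ x, hr, tropicalLinks_projChart_snc_isRsopPart_map_ringEquiv η
    (tropicalLinks_projChart_snc_isRsopPart_of_span_eq hdim hspan), ?_⟩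
  -- `√(ε s) = η(√(s)) = η((∏ x_l)) = (∏ η x_l)`
  have h1 : Ideal.map η (Ideal.span {algebraMap C (Localization.AtPrime (Q.comap ε)) s}) =
      Ideal.span {algebraMap C' (Localization.AtPrime Q) (ε s)} := by
    rw [Ideal.map_span, Set.image_singleton, hη]
  have h2 : Ideal.map η (Ideal.span {∏ l, x l}) = Ideal.span {∏ l, (η ∘ x) l} := by
    rw [Ideal.map_span, Set.image_singleton, map_prod]
    rfl
  have h3 : Ideal.map η (Ideal.span {algebraMap C (Localization.AtPrime (Q.comap ε)) s}).radical =
      (Ideal.map η (Ideal.span {algebraMap C (Localization.AtPrime (Q.comap ε)) s})).radical := by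
    rw [← Ideal.comap_symm, ← Ideal.comap_symm, Ideal.comap_radical]
  rw [← h1, ← h2, ← hrad, h3]

/-- **The chart isomorphism `C_i ≅ 𝒞_{i+1}`.** For `fᵢ ≠ 0` the lift `φ : B[fᵢ⁻¹] →ₐ[k] K` of
`B → K = Frac B` is injective (`B` is a domain) with `φ (1/fᵢ) = (fᵢ)⁻¹`, so it sends the
generator family `(1/fᵢ, fⱼ/fᵢ)` of the abstract chart to the generator family
`(f'_j · (f'_{i+1})⁻¹)_j` of the concrete chart `𝒞_{i+1} ⊆ K`; hence the two evaluations have the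
same kernel and `k[X₀ … X_n] ⧸ ker ≅ range = adjoin`, a ring isomorphism `ε` mapping the class of
`X₀` to `(f'_{i+1})⁻¹ = 1/fᵢ`. [folklore] -/
theorem tropicalLinks_projChart_snc_exists_chartEquiv (k : Type) [Field k] (B : Type) [CommRing B]
    [IsDomain B] [Algebra k B] (K : Type) [Field K] [Algebra B K] [IsFractionRing B K] [Algebra k K]
    [IsScalarTower k B K] (n : ℕ) (f : Fin n → B) (i : Fin n) (hi : f i ≠ 0) :
    ∃ ε : (MvPolynomial (Fin (n + 1)) k ⧸ RingHom.ker (MvPolynomial.aeval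
        (Fin.cons (IsLocalization.Away.invSelf (f i)) (fun j => algebraMap (B)
          (Localization.Away (f i)) (f j) * IsLocalization.Away.invSelf (f i)) :
            Fin (n + 1) → Localization.Away (f i)) :
        MvPolynomial (Fin (n + 1)) k →ₐ[k] Localization.Away (f i))) ≃+*
      ↥(Algebra.adjoin k (Set.range fun j : Fin (n + 1) => algebraMap B K
        ((Fin.cons (1 : B) f : Fin (n + 1) → B) j) *
          (algebraMap B K ((Fin.cons (1 : B) f : Fin (n + 1) → B) i.succ))⁻¹)),
      ((ε (Ideal.Quotient.mk _ (MvPolynomial.X 0)) : ↥(Algebra.adjoin k (Set.range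
        fun j : Fin (n + 1) => algebraMap B K ((Fin.cons (1 : B) f : Fin (n + 1) → B) j) *
          (algebraMap B K ((Fin.cons (1 : B) f : Fin (n + 1) → B) i.succ))⁻¹))) : K) =
        (algebraMap B K ((Fin.cons (1 : B) f : Fin (n + 1) → B) i.succ))⁻¹ := by
  have hc : (Fin.cons (1 : B) f : Fin (n + 1) → B) i.succ = f i := Fin.cons_succ _ _ _
  -- the lift `φ : B[fᵢ⁻¹] →ₐ[k] K`
  have hf : ∀ y : Submonoid.powers (f i), IsUnit (IsScalarTower.toAlgHom k B K y) := by
    rintro ⟨y, m, rfl⟩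
    rw [IsScalarTower.toAlgHom_apply, map_pow]
    exact isUnit_iff_ne_zero.mpr
      (pow_ne_zero _ ((map_ne_zero_iff _ (IsFractionRing.injective B K)).mpr hi))
  set φ : Localization.Away (f i) →ₐ[k] K :=
    IsLocalization.liftAlgHom (M := Submonoid.powers (f i)) hf with hφ
  have hφalg : ∀ b : B, φ (algebraMap B (Localization.Away (f i)) b) = algebraMap B K b :=
    fun b => by
    rw [hφ, IsLocalization.liftAlgHom_apply, IsLocalization.lift_eq]
    rfl
  have hφinv : φ (IsLocalization.Away.invSelf (f i)) = (algebraMap B K (f i))⁻¹ := by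
    apply eq_inv_of_mul_eq_one_right
    rw [← hφalg, ← map_mul, IsLocalization.Away.mul_invSelf, map_one]
  have hφinj : Function.Injective φ := by
    rw [hφ, IsLocalization.coe_liftAlgHom, IsLocalization.lift_injective_iff]
    intro a b
    constructor
    · intro hab
      exact congrArg _ (IsLocalization.injective (Localization.Away (f i))
        (powers_le_nonZeroDivisors_of_noZeroDivisors hi) hab)
    · intro hab
      exact congrArg _ (IsFractionRing.injective B K hab)
  -- `φ` maps the abstract generator family to the concrete one
  have hz : (fun j => φ ((Fin.cons (IsLocalization.Away.invSelf (f i)) (fun j => algebraMap (B)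
      (Localization.Away (f i)) (f j) * IsLocalization.Away.invSelf (f i)) :
        Fin (n + 1) → Localization.Away (f i)) j)) = fun j : Fin (n + 1) => algebraMap B K
          ((Fin.cons (1 : B) f : Fin (n + 1) → B) j) *
            (algebraMap B K ((Fin.cons (1 : B) f : Fin (n + 1) → B) i.succ))⁻¹ := by
    funext j
    refine Fin.cases ?_ (fun j => ?_) j
    · rw [Fin.cons_zero, Fin.cons_zero, hc, hφinv, map_one, one_mul]
    · rw [Fin.cons_succ, Fin.cons_succ, hc, map_mul, hφalg, hφinv]
  -- hence the same kernel
  have hker : RingHom.ker (MvPolynomial.aeval (Fin.cons (IsLocalization.Away.invSelf (f i))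
      (fun j => algebraMap (B) (Localization.Away (f i)) (f j) * IsLocalization.Away.invSelf (f i)) :
        Fin (n + 1) → Localization.Away (f i)) :
          MvPolynomial (Fin (n + 1)) k →ₐ[k] Localization.Away (f i)) =
      RingHom.ker (MvPolynomial.aeval (fun j : Fin (n + 1) => algebraMap B K
        ((Fin.cons (1 : B) f : Fin (n + 1) → B) j) *
          (algebraMap B K ((Fin.cons (1 : B) f : Fin (n + 1) → B) i.succ))⁻¹) :
            MvPolynomial (Fin (n + 1)) k →ₐ[k] K) := by
    ext p
    rw [RingHom.mem_ker, RingHom.mem_ker, ← hz, ← MvPolynomial.comp_aeval, AlgHom.comp_apply,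
      map_eq_zero_iff φ hφinj]
  -- and the range of the concrete evaluation is the adjoin
  have hadj : (MvPolynomial.aeval (fun j : Fin (n + 1) => algebraMap B K
      ((Fin.cons (1 : B) f : Fin (n + 1) → B) j) *
        (algebraMap B K ((Fin.cons (1 : B) f : Fin (n + 1) → B) i.succ))⁻¹) :
          MvPolynomial (Fin (n + 1)) k →ₐ[k] K).range =
      Algebra.adjoin k (Set.range fun j : Fin (n + 1) => algebraMap B K
        ((Fin.cons (1 : B) f : Fin (n + 1) → B) j) *
          (algebraMap B K ((Fin.cons (1 : B) f : Fin (n + 1) → B) i.succ))⁻¹) :=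
    (Algebra.adjoin_range_eq_range_aeval k _).symm
  refine ⟨(((Ideal.quotientEquivAlgOfEq k hker).trans (Ideal.quotientKerEquivRange _)).trans
    (Subalgebra.equivOfEq _ _ hadj)).toRingEquiv, ?_⟩
  rw [AlgEquiv.coe_ringEquiv, AlgEquiv.trans_apply, AlgEquiv.trans_apply,
    Ideal.quotientEquivAlgOfEq_mk, Subalgebra.equivOfEq_apply]
  simp only [Ideal.quotientKerEquivRange, AlgEquiv.trans_apply, Ideal.quotientEquivAlgOfEq_mk,
    Ideal.quotientKerAlgEquivOfSurjective_mk]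
  simp [Fin.cons_zero]

/-- **The boundary of the concrete charts of the projective closure is a strict normal crossings
divisor** (producer brick DTb). Let `B` be a domain over the field `k`, `f : Fin n → B`,
`K = Frac B`, `f' := Fin.cons 1 f`. Assume the snc clause of the datum: for every `i` and every
prime `P` of the abstract chart `C_i = k[X₀ … X_n] ⧸ ker (X₀ ↦ 1/fᵢ, X_{j+1} ↦ fⱼ/fᵢ)` containing
the class of `X₀`, the local ring `(C_i)_P` has dimension `r + e` (`r ≥ 1`), maximal ideal
`(x, y)` and `√(X₀) = (∏ x_l)`. Then for every `h` with `f'_h ≠ 0`, every prime `Q` of the chart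
subalgebra `𝒞_h = k[f'_j / f'_h : j] ⊆ K` and every `t ∈ Q` with `t · f'_h = 1`, there is a part
`x` of a regular system of parameters of `(𝒞_h)_Q` of length `r ≥ 1` with `√(t) = (∏ x_l)`.
For `h = 0`, `t = 1 ∈ Q` is absurd; for `h = i + 1` this is the datum at `P = ε⁻¹ Q` transported
along the chart isomorphism `ε : C_i ≅ 𝒞_h`, `ε [X₀] = t`
(`tropicalLinks_projChart_snc_exists_chartEquiv`, `tropicalLinks_projChart_snc_transport`).
[folklore] -/
theorem tropicalLinks_projChart_snc : ∀ (k : Type) [Field k] (B : Type) [CommRing B] [IsDomain B] [Algebra k B] (K : Type) [Field K] [Algebra B K] [IsFractionRing B K] [Algebra k K] [IsScalarTower k B K] (n : ℕ) (f : Fin n → B), (∀ (i : Fin n) (P : Ideal (MvPolynomial (Fin (n + 1)) k ⧸ RingHom.ker (MvPolynomial.aeval (Fin.cons (IsLocalization.Away.invSelf (f i)) (fun j => algebraMap (B) (Localization.Away (f i)) (f j) * IsLocalization.Away.invSelf (f i)) : Fin (n + 1) → Localization.Away (f i)) : MvPolynomial (Fin (n + 1)) k →ₐ[k] Localization.Away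 (f i)))) [P.IsPrime], (Ideal.Quotient.mk (RingHom.ker (MvPolynomial.aeval (Fin.cons (IsLocalization.Away.invSelf (f i)) (fun j => algebraMap (B) (Localization.Away (f i)) (f j) * IsLocalization.Away.invSelf (f i)) : Fin (n + 1) → Localization.Away (f i)) : MvPolynomial (Fin (n + 1)) k →ₐ[k] Localization.Away (f i))) (MvPolynomial.X 0) : (MvPolynomial (Fin (n + 1)) k ⧸ RingHom.ker (MvPolynomial.aeval (Fin.cons (IsLocalization.Away.invSelf (f i)) (fun j => algebraMap (B) (Localization.Away (f i)) (f j) * IsLocalization.Away.invSelf (f i)) : Fin (n + 1) → Localization.Away (f i)) : MvPolynomial (Fin (n + 1)) k →ₐ[k] Localization.Away (f i)))) ∈ P → ∃ (r e : ℕ) (x : Fin r → Localization.AtPrime P) (y : Fin e → Localization.AtPrime P), 1 ≤ r ∧ ringKrullDim (Localization.AtPrime P) = ((r + e : ℕ) : WithBot ℕ∞) ∧ Ideal.span (Set.range x ∪ Set.range y) = IsLocalRing.maximalIdeal (Localization.AtPrime P) ∧ (Ideal.span {algebraMap (MvPolynomial (Fin (n + 1)) k ⧸ RingHom.ker (MvPolynomial.aeval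 (Fin.cons (IsLocalization.Away.invSelf (f i)) (fun j => algebraMap (B) (Localization.Away (f i)) (f j) * IsLocalization.Away.invSelf (f i)) : Fin (n + 1) → Localization.Away (f i)) : MvPolynomial (Fin (n + 1)) k →ₐ[k] Localization.Away (f i))) (Localization.AtPrime P) (Ideal.Quotient.mk (RingHom.ker (MvPolynomial.aeval (Fin.cons (IsLocalization.Away.invSelf (f i)) (fun j => algebraMap (B) (Localization.Away (f i)) (f j) * IsLocalization.Away.invSelf (f i)) : Fin (n + 1) → Localization.Away (f i)) : MvPolynomial (Fin (n + 1)) k →ₐ[k] Localization.Away (f i))) (MvPolynomial.X 0) : (MvPolynomial (Fin (n + 1)) k ⧸ RingHom.ker (MvPolynomial.aeval (Fin.cons (IsLocalization.Away.invSelf (f i)) (fun j => algebraMap (B) (Localization.Away (f i)) (f j) * IsLocalization.Away.invSelf (f i)) : Fin (n + 1) → Localization.Away (f i)) : MvPolynomial (Fin (n + 1)) k →ₐ[k] Localization.Away (f i))))}).radical = Ideal.span {∏ l, x l}) → ∀ (h : Fin (n + 1)), (Fin.cons (1 : B) f : Fin (n + 1) → B) h ≠ 0 → ∀ (Q : Ideal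 ↥(Algebra.adjoin k (Set.range fun j : Fin (n + 1) => algebraMap B K ((Fin.cons (1 : B) f : Fin (n + 1) → B) j) * (algebraMap B K ((Fin.cons (1 : B) f : Fin (n + 1) → B) h))⁻¹))) [Q.IsPrime] (t : ↥(Algebra.adjoin k (Set.range fun j : Fin (n + 1) => algebraMap B K ((Fin.cons (1 : B) f : Fin (n + 1) → B) j) * (algebraMap B K ((Fin.cons (1 : B) f : Fin (n + 1) → B) h))⁻¹))), (t : K) * algebraMap B K ((Fin.cons (1 : B) f : Fin (n + 1) → B) h) = 1 → t ∈ Q → ∃ (r : ℕ) (x : Fin r → Localization.AtPrime Q), 1 ≤ r ∧ Literature.AlgebraicGeometry.Resolution.IsRsopPart x ∧ (Ideal.span {algebraMap ↥(Algebra.adjoin k (Set.range fun j : Fin (n + 1) => algebraMap B K ((Fin.cons (1 : B) f : Fin (n + 1) → B) j) * (algebraMap B K ((Fin.cons (1 : B) f : Fin (n + 1) → B) h))⁻¹)) (Localization.AtPrime Q) t}).radical = Ideal.span {∏ l, x l} := by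
  intro k _ B _ _ _ K _ _ _ _ _ n f hsnc h hh Q _ t ht htQ
  rcases Fin.eq_zero_or_eq_succ h with rfl | ⟨i, rfl⟩
  · -- `h = 0`: `f'₀ = 1`, so `t = 1 ∈ Q`, absurd
    exfalso
    have h1 : (t : K) = 1 := by
      simpa only [Fin.cons_zero, map_one, mul_one] using ht
    have h2 : t = 1 := OneMemClass.coe_eq_one.mp h1
    rw [h2] at htQ
    exact (Ideal.IsPrime.ne_top ‹_›) ((Ideal.eq_top_iff_one Q).mpr htQ)
  · -- `h = i + 1`: transport along the chart isomorphism `ε : C_i ≅ 𝒞_h`, `ε [X₀] = t`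
    have hi : f i ≠ 0 := by
      intro h0
      apply hh
      rw [Fin.cons_succ]
      exact h0
    obtain ⟨ε, hε⟩ := tropicalLinks_projChart_snc_exists_chartEquiv k B K n f i hi
    have hεt : ε (Ideal.Quotient.mk _ (MvPolynomial.X 0)) = t := by
      apply Subtype.ext
      rw [hε]
      exact (eq_inv_of_mul_eq_one_left ht).symm
    have key := tropicalLinks_projChart_snc_transport ε _ (hsnc i) Q (hεt ▸ htQ)
    rw [hεt] at key
    exact key

end Summit.ResolutionOfSingularities.ResolutionOfSingularities.Theorems
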